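import Literature.Geometry.Kaehler.HolomorphicLineBundleCechRestrict
import Literature.Geometry.Kaehler.NestedChartConvexCoversSubordinate
import Literature.Geometry.Kaehler.DolbeaultLerayBanach
import Literature.Analysis.OperatorTheory.SchwartzFiniteness
import HarnessLib

/-!
# The Cartan–Serre finiteness theorem with coefficients in a holomorphic line bundle:
# `dim H^{0,1}(M, L) = dim H¹(M, 𝒪(L)) < ∞` for compact complex manifolds

Layer `Literature/Geometry/Kaehler`. For a holomorphic line cocycle `L` (`HolomorphicLineBundle`) on
a compact Hausdorff complex manifold `M` modelled on a finite-dimensional `E`, the twisted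
Dolbeault group `L.H01 = H^{0,1}(M, L)` (`HolomorphicLineBundleDolbeault`) is finite-dimensional —
H. Cartan, J.-P. Serre (1953) for the coherent sheaf `𝒪(L)`, in the organisation of H. Grauert,
R. Remmert, *Theorie der Steinschen Räume* (1977), Kap. VI §4, exactly as the tree's untwisted
`finite_dolbeaultCohomology_holds` (`DolbeaultCartanSerreProofs`), whose Banach-space machinery
(`DolbeaultLerayBanach`: bounded holomorphic cochains `Bdd`, their sup norms, completeness,
compactness of restriction by Montel) is REUSED with `p = 0`:

1. `L.TwistedLerayDatum` — a nested Leray datum `𝔘₀ ≪ 𝔘₁ ≪ 𝔘₂ ≪ 𝔘₃` (`DolbeaultLerayDatum`)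
   together with a refinement map `τ` into the trivialising cover of `L`, `U_{l,i} ⊆ U_{τ i}`
   (exists on compact `M`: `exists_nestedChartConvexCovers_subordinate`); its levels are
   refinements `D.refinement l` of the trivialising cover in the sense of
   `HolomorphicLineBundleDolbeault`, all `∂̄`-acyclic (convex chart sets), shrinking in `l`;
2. the holomorphic function cochains underlying the bounded `(0,0)`-form cochains (`fun0`,
   `fun1`), the closed subspace **`D.Zt l ≤ Bdd_l¹` of bounded TWISTED cocycles**
   (`c_ad = t_bd c_ab + c_bd`; closed because point evaluations are bounded by the sup norm),
   restriction `resZt` (compact for `l < l'`, Montel), the **bounded twisted coboundary**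
   `tdelta : Bdd_l⁰ → Zt_l`, `(δ b)_ab = b_b - t_ab b_a` (bounded below the top level: `t_ab` is
   bounded on `closure U_{l,ab} ⊆ U_{l',ab}`), and the class map `cls : Zt_l → Ȟ¹(𝔘_l, 𝒪(L))`;
3. the cohomological inputs of L. Schwartz's finiteness theorem
   (`Module.finite_of_compact_restriction`): `cls ∘ tdelta = 0`, every class of level `0` is the
   class of a bounded cocycle restricted from level `1` (`exists_cls_resZt_eq`), and controlled
   solvability `res res x = res y + δ w` (`exists_resZt_resZt_eq_add_tdelta`) — from the
   bijectivity of restriction `Ȟ¹(𝔘_{l'}, 𝒪(L)) → Ȟ¹(𝔘_l, 𝒪(L))` between acyclic levels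
   (`resH1_bijective`, through the Čech–Dolbeault comparison) and the boundedness of algebraic
   restriction to a strictly lower level (`memℓp_cechHolShrink_of_lt`);
4. **`TwistedLerayDatum.finite_H1`**: `dim Ȟ¹(𝔘₀, 𝒪(L)) < ∞`, and by Leray
   (`nonempty_H1_equiv_H01`) **`HolomorphicLineBundle.finite_H01 : Module.Finite ℂ L.H01`**.

Everything is proved; the definitions are the datum and the operators listed above.

## References

* H. Cartan, J.-P. Serre, *Un théorème de finitude concernant les variétés analytiques compactes*,
  C. R. Acad. Sci. Paris 237 (1953) 128–130. [CartanSerre1953]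
* H. Grauert, R. Remmert, *Theorie der Steinschen Räume* (1977), Kap. VI §4. [GrauertRemmert1977]
* C. Voisin, *Hodge Theory and Complex Algebraic Geometry I* (2002), §4.3.1, Thm. 4.41, Cor. 5.25.
  [VoisinHodgeI2002]
-/

noncomputable section

open scoped Manifold ContDiff Topology
open Set Filter Function
open Literature.NumberTheory.Transcendental Literature.Analysis.OperatorTheory

namespace Literature.Geometry.Kaehler

variable {ι : Type*} {E : Type*} [NormedAddCommGroup E] [NormedSpace ℂ E]
  {M : Type*} [TopologicalSpace M] [ChartedSpace E M]

/-! ### Pairs of indices and values of `0`-forms -/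

omit [TopologicalSpace M] [ChartedSpace E M] in
/-- The intersection attached to a `2`-tuple `(a, b)` is `U_a ∩ U_b`. [folklore] -/
theorem cechSet_fin_two {κ : Type*} (U : κ → Set M) (J : Fin 2 → κ) : cechSet U J = U (J 0) ∩ U (J 1) := by
  ext x
  simp only [mem_cechSet_iff, Fin.forall_fin_two, mem_inter_iff]

/-- **The value of a `0`-form is bounded by the norm of its chart representative** (the
representative at `y` is the constant `0`-form `α(φ⁻¹ y)`). [folklore] -/
theorem MForm.norm_apply_zero_le_norm_inChart (α : MForm 𝓘(ℝ, E) M ℂ 0) (x₀ : M) (y : E) :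
    ‖α ((extChartAt 𝓘(ℝ, E) x₀).symm y) 0‖ ≤ ‖α.inChart x₀ y‖ := by
  have h := (α.inChart x₀ y).le_opNorm 0
  rw [MForm.inChart_apply] at h
  simp only [Finset.univ_eq_empty, Finset.prod_empty, mul_one] at h
  have e : (fun i : Fin 0 ↦ mfderivWithin 𝓘(ℝ, E) 𝓘(ℝ, E) (extChartAt 𝓘(ℝ, E) x₀).symm (range 𝓘(ℝ, E)) y
      ((0 : Fin 0 → E) i)) = 0 := Subsingleton.elim _ _
  rwa [e] at h

/-- The norm of the chart representative of the `0`-form of a function is the absolute value of the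
function at the charted point. [folklore] -/
theorem MForm.norm_inChart_ofFun (f : M → ℂ) (x₀ : M) (y : E) :
    ‖(MForm.ofFun 𝓘(ℝ, E) f).inChart x₀ y‖ = ‖f ((extChartAt 𝓘(ℝ, E) x₀).symm y)‖ := by
  rw [MForm.inChart_ofFun, ContinuousAlternatingMap.norm_constOfIsEmpty]

section HolOfFun

variable [FiniteDimensional ℂ E] [T2Space M] [IsManifold 𝓘(ℂ, E) ω M] [IsManifold 𝓘(ℝ, E) ∞ M]

/-- **The holomorphic `(0,0)`-form on an open `W` of a function holomorphic on `W` and zero off `W`**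
(`∂̄ f = 0` on `W` by Cauchy–Riemann). [cite: VoisinHodgeI2002, §2.3.3] -/
def holOfFun {W : Set M} (hW : IsOpen W) (f : M → ℂ) (hf : MDifferentiableOn 𝓘(ℂ, E) 𝓘(ℂ, ℂ) f W)
    (h0 : ∀ x ∉ W, f x = 0) : ↥(holFormsOn E M hW 0) :=
  ⟨⟨MForm.ofFun 𝓘(ℝ, E) f, HolomorphicLineBundle.Refinement.mem_pqFormsOn_zero_zero_iff.2
      (HolomorphicLineBundle.Refinement.ofFun_mem_smoothFormsOn hW hf h0)⟩,
    (mem_holFormsOn_iff 0 hW).2 (Subtype.ext (funext fun x ↦ by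
      rw [coe_localDbar, Submodule.coe_zero, Pi.zero_apply]
      by_cases hx : x ∈ W
      · rw [MForm.restr_apply_of_mem _ hx]
        exact dolbeaultBar_ofFun_eq_zero_of_mdifferentiableOn hW hf hx
      · exact MForm.restr_apply_of_notMem _ hx))⟩

/-- Underlying form of `holOfFun` (definitional). [folklore] -/
@[simp] theorem coe_coe_holOfFun {W : Set M} (hW : IsOpen W) (f : M → ℂ)
    (hf : MDifferentiableOn 𝓘(ℂ, E) 𝓘(ℂ, ℂ) f W) (h0 : ∀ x ∉ W, f x = 0) :
    ((holOfFun hW f hf h0 : ↥(pqFormsOn E M W 0 0)) : MForm 𝓘(ℝ, E) M ℂ (0 + 0)) = MForm.ofFun 𝓘(ℝ, E) f :=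
  rfl

/-- **The function of a holomorphic `(0,0)`-form on an open `W` is holomorphic on `W`** (it is real
smooth with `∂̄ = 0` there: Cauchy–Riemann, `mdifferentiableOn_of_dolbeaultBar_ofFun_eq_zero`).
[cite: VoisinHodgeI2002, §2.3.3] -/
theorem mdifferentiableOn_apply_zero_of_mem_holFormsOn {W : Set M} (hW : IsOpen W) (g : ↥(holFormsOn E M hW 0)) :
    MDifferentiableOn 𝓘(ℂ, E) 𝓘(ℂ, ℂ)
      (fun x ↦ ((g : ↥(pqFormsOn E M W 0 0)) : MForm 𝓘(ℝ, E) M ℂ (0 + 0)) x 0) W := by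
  have hg := (mem_holFormsOn_iff 0 hW).1 g.2
  refine mdifferentiableOn_of_dolbeaultBar_ofFun_eq_zero (fun x hx ↦ ?_) (fun x hx ↦ ?_)
  · rw [MForm.ofFun_apply_zero_eq]
    exact (g : ↥(pqFormsOn E M W 0 0)).2.1 x hx
  · rw [MForm.ofFun_apply_zero_eq, ← localDbar_apply_of_mem hW _ hx, hg]
    rfl

end HolOfFun

namespace HolomorphicLineBundle

/-! ### Twisted nested Leray data -/

/-- **A twisted nested Leray datum of the holomorphic line cocycle `L`**: a nested Leray datum
`𝔘₀ ≪ 𝔘₁ ≪ 𝔘₂ ≪ 𝔘₃` of the manifold (`DolbeaultLerayDatum`: finite covers on one index set by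
convex chart sets, nested with closure containments) together with a refinement map `τ` into the
trivialising cover of `L` with `U_{l,i} ⊆ U_{τ i}` (Grauert–Remmert (1977), Kap. VI §4.1: the
Meßatlas is subordinate to a cover presenting the sheaf). [cite: GrauertRemmert1977, Kap. VI §4.1] -/
structure TwistedLerayDatum (L : HolomorphicLineBundle ι E M) extends DolbeaultLerayDatum E M where
  /-- the refinement map into the trivialising cover -/
  τ : ↥s → ι
  /-- every set of every level lies in the trivialising set of its index -/
  subset_baseSet : ∀ l i, U l i ⊆ L.baseSet (τ i)

/-- **Compact complex manifolds carry twisted nested Leray data** for every holomorphic line cocycle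
(`exists_nestedChartConvexCovers_subordinate` with four levels, subordinate to the trivialising
cover). [cite: GrauertRemmert1977, Kap. VI §4.1] -/
theorem nonempty_twistedLerayDatum [FiniteDimensional ℂ E] [T2Space M] [CompactSpace M]
    [IsManifold 𝓘(ℝ, E) ∞ M] (L : HolomorphicLineBundle ι E M) : Nonempty L.TwistedLerayDatum := by
  obtain ⟨s, U, hUo, hcov, hmono, hcl, hchart, hsub⟩ := exists_nestedChartConvexCovers_subordinate (E := E) (M := M) 3
    L.baseSet L.isOpen_baseSet L.exists_mem_baseSet
  choose ctr hctr using hchart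
  have key : ∀ (a : ℕ) (J : Fin (a + 1) → ↥s) (l : Fin 4), ∃ C : Set E, IsOpen C ∧ Convex ℝ C ∧
      C ⊆ (extChartAt 𝓘(ℝ, E) (ctr a J)).target ∧ cechSet (U l) J = chartSet 𝓘(ℝ, E) (ctr a J) C := by
    intro a J l
    rcases (cechSet (U l) J).eq_empty_or_nonempty with h | h
    · exact ⟨∅, isOpen_empty, convex_empty, empty_subset _, by rw [h, chartSet_empty]⟩
    · obtain ⟨C, hC, hCc, hCt, hW⟩ := hctr a J l h
      exact ⟨C, hC, hCc, by rwa [extChartAt_target_eq_chartAt_target], hW⟩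
  choose C hC hCc hCt hW using key
  choose τ hτ using fun i ↦ hsub (Fin.last 3) i
  exact ⟨⟨⟨s, U, hUo, hcov, hmono, hcl, ctr, C, hC, hCc, hCt, hW⟩, τ,
    fun l i ↦ (hmono l (Fin.last 3) (Fin.le_last l) i).trans (hτ i)⟩⟩

namespace TwistedLerayDatum

variable {L : HolomorphicLineBundle ι E M} (D : L.TwistedLerayDatum)

/-- **The level-`l` cover as a refinement of the trivialising cover** (`V = U_l`, refinement map `τ`).
[cite: GrauertRemmert1977, Kap. VI §4.1] -/
def refinement (l : Fin 4) : L.Refinement ↥D.s where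
  V := D.U l
  isOpen := D.isOpen l
  exists_mem x := mem_iUnion.1 ((D.cover l).symm ▸ mem_univ x)
  τ := D.τ
  subset := D.subset_baseSet l

/-- The sets of the level-`l` refinement (definitional). [folklore] -/
@[simp] theorem refinement_V (l : Fin 4) : (D.refinement l).V = D.U l := rfl

/-- The presenting cocycle of every level is `t_ab = g_{τa τb}` (definitional). [folklore] -/
theorem refinement_t (l l' : Fin 4) (a b : ↥D.s) : (D.refinement l).t a b = (D.refinement l').t a b := rfl

/-- **Lower levels shrink higher ones** (same index set, same `τ`). [cite: GrauertRemmert1977, Kap. VI §4.1] -/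
theorem isShrink {l l' : Fin 4} (h : l ≤ l') : (D.refinement l).IsShrink (D.refinement l') :=
  ⟨D.mono l l' h, fun _ ↦ rfl⟩

section Spaces

variable [FiniteDimensional ℂ E] [T2Space M] [IsManifold 𝓘(ℂ, E) ω M] [IsManifold 𝓘(ℝ, E) ∞ M]

/-- **All sets of all levels are `∂̄`-acyclic** (convex chart sets: the `∂̄`-Poincaré lemma).
[cite: VoisinHodgeI2002, Prop. 2.36] -/
theorem isDolbeaultAcyclic (l : Fin 4) (i : ↥D.s) : IsDolbeaultAcyclic E M ((D.refinement l).isOpen i) 0 :=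
  IsDolbeaultAcyclic.of_eq_chartSet 0 _ ((cechSet_fin_one (D.U l) fun _ ↦ i).symm.trans (D.cechSet_eq 0 (fun _ ↦ i) l))
    (D.C_open 0 _ l) (D.C_convex 0 _ l) (D.C_subset 0 _ l)

/-- The bounded holomorphic function `a`-cochains of level `l` (the Banach spaces of
`DolbeaultLerayBanach` with `p = 0`). [cite: GrauertRemmert1977, Kap. VI §4.1] -/
abbrev Bdd (l : Fin 4) (a : ℕ) : Type _ :=
  D.toDolbeaultLerayDatum.Bdd 0 l a

/-! ### The function cochains of holomorphic `(0,0)`-form cochains -/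

/-- The function `0`-cochain `a ↦ b_a` of a holomorphic `0`-cochain of `(0,0)`-forms. [folklore] -/
def fun0 (l : Fin 4) (g : CechHolForms E M (D.U l) (D.isOpen l) 0 0) : ↥D.s → M → ℂ := fun a x ↦
  ((g (fun _ ↦ a) : ↥(pqFormsOn E M (cechSet (D.U l) fun _ : Fin 1 ↦ a) 0 0)) : MForm 𝓘(ℝ, E) M ℂ (0 + 0)) x 0

/-- The function `1`-cochain `(a, b) ↦ c_ab` of a holomorphic `1`-cochain of `(0,0)`-forms. [folklore] -/
def fun1 (l : Fin 4) (g : CechHolForms E M (D.U l) (D.isOpen l) 0 1) : ↥D.s → ↥D.s → M → ℂ := fun a b x ↦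
  ((g ![a, b] : ↥(pqFormsOn E M (cechSet (D.U l) ![a, b]) 0 0)) : MForm 𝓘(ℝ, E) M ℂ (0 + 0)) x 0

omit [FiniteDimensional ℂ E] [T2Space M] [IsManifold 𝓘(ℂ, E) ω M] [IsManifold 𝓘(ℝ, E) ∞ M] in
/-- The overlap of a pair. [folklore] -/
theorem cechSet_vecPair (l : Fin 4) (a b : ↥D.s) : cechSet (D.U l) ![a, b] = D.U l a ∩ D.U l b := by
  rw [cechSet_fin_two]
  rfl

/-- `fun0` is additive. [folklore] -/
theorem fun0_add (l : Fin 4) (g g' : CechHolForms E M (D.U l) (D.isOpen l) 0 0) :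
    D.fun0 l (g + g') = D.fun0 l g + D.fun0 l g' :=
  rfl

/-- `fun0` is homogeneous. [folklore] -/
theorem fun0_smul (l : Fin 4) (r : ℂ) (g : CechHolForms E M (D.U l) (D.isOpen l) 0 0) :
    D.fun0 l (r • g) = r • D.fun0 l g :=
  rfl

/-- `fun1` is additive. [folklore] -/
theorem fun1_add (l : Fin 4) (g g' : CechHolForms E M (D.U l) (D.isOpen l) 0 1) :
    D.fun1 l (g + g') = D.fun1 l g + D.fun1 l g' :=
  rfl

/-- `fun1` is homogeneous. [folklore] -/
theorem fun1_smul (l : Fin 4) (r : ℂ) (g : CechHolForms E M (D.U l) (D.isOpen l) 0 1) :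
    D.fun1 l (r • g) = r • D.fun1 l g :=
  rfl

/-- The components of `fun0` are holomorphic on the sets. [folklore] -/
theorem fun0_mdifferentiableOn (l : Fin 4) (g : CechHolForms E M (D.U l) (D.isOpen l) 0 0) (a : ↥D.s) :
    MDifferentiableOn 𝓘(ℂ, E) 𝓘(ℂ, ℂ) (D.fun0 l g a) (D.U l a) :=
  (mdifferentiableOn_apply_zero_of_mem_holFormsOn _ (g fun _ ↦ a)).mono (cechSet_fin_one (D.U l) fun _ ↦ a).superset

/-- The components of `fun0` vanish off the sets. [folklore] -/
theorem fun0_apply_eq_zero (l : Fin 4) (g : CechHolForms E M (D.U l) (D.isOpen l) 0 0) {a : ↥D.s} {x : M}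
    (hx : x ∉ D.U l a) : D.fun0 l g a x = 0 := by
  have h0 := (g fun _ ↦ a : ↥(pqFormsOn E M (cechSet (D.U l) fun _ : Fin 1 ↦ a) 0 0)).2.2.1 x
    (by rwa [cechSet_fin_one])
  change ((g fun _ ↦ a : ↥(pqFormsOn E M (cechSet (D.U l) fun _ : Fin 1 ↦ a) 0 0)) : MForm 𝓘(ℝ, E) M ℂ (0 + 0)) x 0 = 0
  rw [h0]
  rfl

/-- The function `0`-cochain is a holomorphic `0`-cochain of the level refinement. [folklore] -/
theorem fun0_mem_C0 (l : Fin 4) (g : CechHolForms E M (D.U l) (D.isOpen l) 0 0) : D.fun0 l g ∈ (D.refinement l).C0 :=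
  fun a ↦ ⟨D.fun0_mdifferentiableOn l g a, fun _ hx ↦ D.fun0_apply_eq_zero l g hx⟩

/-- The components of `fun1` are holomorphic on the overlaps. [folklore] -/
theorem fun1_mdifferentiableOn (l : Fin 4) (g : CechHolForms E M (D.U l) (D.isOpen l) 0 1) (a b : ↥D.s) :
    MDifferentiableOn 𝓘(ℂ, E) 𝓘(ℂ, ℂ) (D.fun1 l g a b) (D.U l a ∩ D.U l b) :=
  (mdifferentiableOn_apply_zero_of_mem_holFormsOn _ (g ![a, b])).mono (D.cechSet_vecPair l a b).superset

/-- The components of `fun1` vanish off the overlaps. [folklore] -/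
theorem fun1_apply_eq_zero (l : Fin 4) (g : CechHolForms E M (D.U l) (D.isOpen l) 0 1) {a b : ↥D.s} {x : M}
    (hx : x ∉ D.U l a ∩ D.U l b) : D.fun1 l g a b x = 0 := by
  have h0 := (g ![a, b] : ↥(pqFormsOn E M (cechSet (D.U l) ![a, b]) 0 0)).2.2.1 x (by rwa [cechSet_vecPair])
  change ((g ![a, b] : ↥(pqFormsOn E M (cechSet (D.U l) ![a, b]) 0 0)) : MForm 𝓘(ℝ, E) M ℂ (0 + 0)) x 0 = 0
  rw [h0]
  rfl

/-- **A holomorphic `1`-cochain of `(0,0)`-forms is determined by its function cochain** (every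
`2`-tuple is a pair; a `0`-form is its value). [folklore] -/
theorem ext_of_fun1_eq (l : Fin 4) {g g' : CechHolForms E M (D.U l) (D.isOpen l) 0 1}
    (h : D.fun1 l g = D.fun1 l g') : g = g' := by
  funext J
  apply Subtype.ext
  apply Subtype.ext
  rw [← MForm.ofFun_apply_zero_eq ((g J : ↥(pqFormsOn E M (cechSet (D.U l) J) 0 0)) : MForm 𝓘(ℝ, E) M ℂ (0 + 0)),
    ← MForm.ofFun_apply_zero_eq ((g' J : ↥(pqFormsOn E M (cechSet (D.U l) J) 0 0)) : MForm 𝓘(ℝ, E) M ℂ (0 + 0))]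
  congr 1
  funext z
  have hz := congrFun (congrFun (congrFun h (J 0)) (J 1)) z
  have hJ : J = ![J 0, J 1] := by
    funext k
    fin_cases k <;> rfl
  rw [hJ]
  exact hz

/-- **The holomorphic `1`-cochain of `(0,0)`-forms of a function `1`-cochain** holomorphic on the
overlaps and zero off them. [folklore] -/
def hol1 (l : Fin 4) (f : ↥D.s → ↥D.s → M → ℂ)
    (hf : ∀ a b, MDifferentiableOn 𝓘(ℂ, E) 𝓘(ℂ, ℂ) (f a b) (D.U l a ∩ D.U l b))
    (h0 : ∀ a b, ∀ x ∉ D.U l a ∩ D.U l b, f a b x = 0) : CechHolForms E M (D.U l) (D.isOpen l) 0 1 := fun J ↦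
  holOfFun (isOpen_cechSet (D.isOpen l) J) (f (J 0) (J 1)) (by rw [cechSet_fin_two]; exact hf _ _)
    (by rw [cechSet_fin_two]; exact h0 _ _)

/-- The function cochain of `hol1 f` is `f`. [folklore] -/
theorem fun1_hol1 (l : Fin 4) (f : ↥D.s → ↥D.s → M → ℂ)
    (hf : ∀ a b, MDifferentiableOn 𝓘(ℂ, E) 𝓘(ℂ, ℂ) (f a b) (D.U l a ∩ D.U l b))
    (h0 : ∀ a b, ∀ x ∉ D.U l a ∩ D.U l b, f a b x = 0) : D.fun1 l (D.hol1 l f hf h0) = f := by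
  funext a b x
  exact MForm.ofFun_apply_zero_tuple _ _

/-- **The holomorphic `0`-cochain of `(0,0)`-forms of a function `0`-cochain** holomorphic on the sets
and zero off them. [folklore] -/
def hol0 (l : Fin 4) (f : ↥D.s → M → ℂ) (hf : ∀ a, MDifferentiableOn 𝓘(ℂ, E) 𝓘(ℂ, ℂ) (f a) (D.U l a))
    (h0 : ∀ a, ∀ x ∉ D.U l a, f a x = 0) : CechHolForms E M (D.U l) (D.isOpen l) 0 0 := fun K ↦
  holOfFun (isOpen_cechSet (D.isOpen l) K) (f (K 0)) (by rw [cechSet_fin_one]; exact hf _)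
    (by rw [cechSet_fin_one]; exact h0 _)

/-- The function cochain of `hol0 f` is `f`. [folklore] -/
theorem fun0_hol0 (l : Fin 4) (f : ↥D.s → M → ℂ) (hf : ∀ a, MDifferentiableOn 𝓘(ℂ, E) 𝓘(ℂ, ℂ) (f a) (D.U l a))
    (h0 : ∀ a, ∀ x ∉ D.U l a, f a x = 0) : D.fun0 l (D.hol0 l f hf h0) = f := by
  funext a x
  exact MForm.ofFun_apply_zero_tuple _ _

/-- **Restriction to a lower level on function `1`-cochains is the cut-off** by the smaller overlaps.
[folklore] -/
theorem fun1_cechHolShrink {l l' : Fin 4} (h : l ≤ l') (g : CechHolForms E M (D.U l') (D.isOpen l') 0 1) :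
    D.fun1 l (cechHolShrink E M (D.isOpen l') 0 (D.isOpen l) (D.mono l l' h) 1 g) =
      Refinement.resZ1Fun (D.refinement l) (D.fun1 l' g) := by
  funext a b x
  change ((((g ![a, b] : ↥(pqFormsOn E M (cechSet (D.U l') ![a, b]) 0 0)) : MForm 𝓘(ℝ, E) M ℂ (0 + 0))).restr
    (cechSet (D.U l) ![a, b])) x 0 = _
  by_cases hx : x ∈ D.U l a ∩ D.U l b
  · rw [MForm.restr_apply_of_mem _ (by rwa [cechSet_vecPair]), Refinement.resZ1Fun_apply_of_mem _ hx]
    rfl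
  · rw [MForm.restr_apply_of_notMem _ (by rwa [cechSet_vecPair]), Refinement.resZ1Fun_apply_of_notMem _ hx]
    rfl

/-- **Restriction to a lower level on function `0`-cochains is the cut-off** by the smaller sets.
[folklore] -/
theorem fun0_cechHolShrink {l l' : Fin 4} (h : l ≤ l') (g : CechHolForms E M (D.U l') (D.isOpen l') 0 0) :
    D.fun0 l (cechHolShrink E M (D.isOpen l') 0 (D.isOpen l) (D.mono l l' h) 0 g) =
      Refinement.resC0Fun (D.refinement l) (D.fun0 l' g) := by
  funext a x
  change ((((g fun _ ↦ a : ↥(pqFormsOn E M (cechSet (D.U l') fun _ : Fin 1 ↦ a) 0 0)) :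
    MForm 𝓘(ℝ, E) M ℂ (0 + 0))).restr (cechSet (D.U l) fun _ : Fin 1 ↦ a)) x 0 = _
  by_cases hx : x ∈ D.U l a
  · rw [MForm.restr_apply_of_mem _ (by rwa [cechSet_fin_one]), Refinement.resC0Fun_apply_of_mem _ hx]
    rfl
  · rw [MForm.restr_apply_of_notMem _ (by rwa [cechSet_fin_one]), Refinement.resC0Fun_apply_of_notMem _ hx]
    rfl

/-- The function cochain of a restricted bounded `1`-cochain. [folklore] -/
theorem fun1_res {l l' : Fin 4} (h : l ≤ l') (c : D.Bdd l' 1) :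
    D.fun1 l (D.toDolbeaultLerayDatum.res 0 h 1 c).val = Refinement.resZ1Fun (D.refinement l) (D.fun1 l' c.val) :=
  D.fun1_cechHolShrink h c.val

/-! ### Values are bounded by the sup norm -/

/-- **The values of a bounded cochain are bounded by its norm** (the value at `x ∈ U_{l,J}` is the
value of the representative at the charted point, a point of `C_{l,J}`). [cite: GrauertRemmert1977, Kap. VI §4.1] -/
theorem norm_apply_zero_le {l : Fin 4} {a : ℕ} (c : D.Bdd l a) (J : Fin (a + 1) → ↥D.s) {x : M}
    (hx : x ∈ cechSet (D.U l) J) :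
    ‖((c.val J : ↥(pqFormsOn E M (cechSet (D.U l) J) 0 0)) : MForm 𝓘(ℝ, E) M ℂ (0 + 0)) x 0‖ ≤ ‖c‖ := by
  have h1 := D.toDolbeaultLerayDatum.norm_inChart_le 0 c (D.extChartAt_mem_C hx)
  have h2 := MForm.norm_apply_zero_le_norm_inChart
    ((c.val J : ↥(pqFormsOn E M (cechSet (D.U l) J) 0 0)) : MForm 𝓘(ℝ, E) M ℂ (0 + 0)) (D.ctr a J)
    (extChartAt 𝓘(ℝ, E) (D.ctr a J) x)
  rw [(extChartAt 𝓘(ℝ, E) _).left_inv (D.cechSet_subset_source l J hx)] at h2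
  exact h2.trans h1

/-- The values of `fun1` are bounded by the norm. [folklore] -/
theorem norm_fun1_le {l : Fin 4} (c : D.Bdd l 1) (a b : ↥D.s) (x : M) : ‖D.fun1 l c.val a b x‖ ≤ ‖c‖ := by
  by_cases hx : x ∈ D.U l a ∩ D.U l b
  · exact D.norm_apply_zero_le c ![a, b] (by rwa [cechSet_vecPair])
  · rw [D.fun1_apply_eq_zero l c.val hx, norm_zero]
    exact norm_nonneg _

/-- The values of `fun0` are bounded by the norm. [folklore] -/
theorem norm_fun0_le {l : Fin 4} (c : D.Bdd l 0) (a : ↥D.s) (x : M) : ‖D.fun0 l c.val a x‖ ≤ ‖c‖ := by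
  by_cases hx : x ∈ D.U l a
  · exact D.norm_apply_zero_le c (fun _ ↦ a) (by rwa [cechSet_fin_one])
  · rw [D.fun0_apply_eq_zero l c.val hx, norm_zero]
    exact norm_nonneg _

/-- **Point evaluation of bounded `1`-cochains, a bounded linear functional.**
[cite: GrauertRemmert1977, Kap. VI §4.1] -/
def evalCLM (l : Fin 4) (a b : ↥D.s) (x : M) : D.Bdd l 1 →L[ℂ] ℂ :=
  LinearMap.mkContinuous
    { toFun := fun c ↦ D.fun1 l c.val a b x
      map_add' := fun _ _ ↦ rfl
      map_smul' := fun _ _ ↦ rfl } 1 fun c ↦ by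
    rw [one_mul]
    exact D.norm_fun1_le c a b x

/-- Point evaluation, unfolded. [folklore] -/
@[simp] theorem evalCLM_apply (l : Fin 4) (a b : ↥D.s) (x : M) (c : D.Bdd l 1) :
    D.evalCLM l a b x c = D.fun1 l c.val a b x :=
  rfl

/-! ### The bounded twisted cocycles -/

/-- The function `1`-cochain of a bounded cochain, linearly. [folklore] -/
def fun1ₗ (l : Fin 4) : D.Bdd l 1 →ₗ[ℂ] (↥D.s → ↥D.s → M → ℂ) where
  toFun c := D.fun1 l c.val
  map_add' _ _ := rfl
  map_smul' _ _ := rfl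

/-- **The bounded twisted cocycles of level `l`**, `Z¹_b(𝔘_l, 𝒪(L))`: the bounded holomorphic
`1`-cochains whose function cochain is a twisted cocycle (`c_ad = t_bd c_ab + c_bd` on triple
overlaps). [cite: GrauertRemmert1977, Kap. VI §4.3] -/
def Zt (l : Fin 4) : Submodule ℂ (D.Bdd l 1) :=
  ((D.refinement l).Z1).comap (D.fun1ₗ l)

/-- Membership in the bounded twisted cocycles: the function cochain is a twisted cocycle. [folklore] -/
theorem mem_Zt_iff' {l : Fin 4} {c : D.Bdd l 1} : c ∈ D.Zt l ↔ D.fun1 l c.val ∈ (D.refinement l).Z1 :=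
  Iff.rfl

/-- Membership in the bounded twisted cocycles: the cocycle identity (holomorphy on the overlaps and
vanishing off them are automatic). [cite: GrauertRemmert1977, Kap. VI §4.3] -/
theorem mem_Zt_iff {l : Fin 4} {c : D.Bdd l 1} :
    c ∈ D.Zt l ↔ ∀ a b d, ∀ x ∈ D.U l a ∩ D.U l b ∩ D.U l d,
      D.fun1 l c.val a d x = (D.refinement l).t b d x * D.fun1 l c.val a b x + D.fun1 l c.val b d x :=
  ⟨fun h ↦ h.2.2, fun h ↦ ⟨fun a b ↦ D.fun1_mdifferentiableOn l c.val a b,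
    fun _ _ _ hx ↦ D.fun1_apply_eq_zero l c.val hx, h⟩⟩

/-- **The bounded twisted cocycles form a closed subspace** (an intersection of kernels of bounded
point evaluations). [cite: GrauertRemmert1977, Kap. VI §4.3] -/
theorem isClosed_Zt (l : Fin 4) : IsClosed (D.Zt l : Set (D.Bdd l 1)) := by
  have h : (D.Zt l : Set (D.Bdd l 1)) = ⋂ a, ⋂ b, ⋂ d, ⋂ x, ⋂ (_ : x ∈ D.U l a ∩ D.U l b ∩ D.U l d),
      {c | D.evalCLM l a d x c = (D.refinement l).t b d x * D.evalCLM l a b x c + D.evalCLM l b d x c} := by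
    ext c
    simp only [SetLike.mem_coe, mem_Zt_iff, mem_iInter, mem_setOf_eq, evalCLM_apply]
  rw [h]
  exact isClosed_iInter fun a ↦ isClosed_iInter fun b ↦ isClosed_iInter fun d ↦ isClosed_iInter fun x ↦
    isClosed_iInter fun _ ↦ isClosed_eq (D.evalCLM l a d x).continuous
      ((continuous_const.mul (D.evalCLM l a b x).continuous).add (D.evalCLM l b d x).continuous)

/-- The bounded twisted cocycles form a Banach space. [cite: GrauertRemmert1977, Kap. VI §4.3] -/
instance instCompleteSpaceZt (l : Fin 4) : CompleteSpace ↥(D.Zt l) :=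
  (D.isClosed_Zt l).completeSpace_coe

/-- A bounded `1`-cochain is determined by its function cochain. [folklore] -/
theorem Bdd_ext_of_fun1_eq {l : Fin 4} {c c' : D.Bdd l 1} (h : D.fun1 l c.val = D.fun1 l c'.val) : c = c' :=
  DolbeaultLerayDatum.Bdd.ext (D.ext_of_fun1_eq l h)

/-- **The twisted cocycle of a bounded twisted cocycle** (its function cochain). [folklore] -/
def toZ1 (l : Fin 4) : ↥(D.Zt l) →ₗ[ℂ] (D.refinement l).Z1 where
  toFun y := ⟨D.fun1 l (y : D.Bdd l 1).val, y.2⟩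
  map_add' _ _ := rfl
  map_smul' _ _ := rfl

/-- Underlying function cochain of `toZ1` (definitional). [folklore] -/
@[simp] theorem coe_toZ1 {l : Fin 4} (y : ↥(D.Zt l)) :
    (D.toZ1 l y : ↥D.s → ↥D.s → M → ℂ) = D.fun1 l (y : D.Bdd l 1).val :=
  rfl

/-- **The class map `Z¹_b(𝔘_l, 𝒪(L)) → Ȟ¹(𝔘_l, 𝒪(L))`.** [cite: GrauertRemmert1977, Kap. VI §4.3] -/
def cls (l : Fin 4) : ↥(D.Zt l) →ₗ[ℂ] (D.refinement l).H1 :=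
  (Refinement.H1.mk (D.refinement l)).comp (D.toZ1 l)

/-- The class map, unfolded. [folklore] -/
theorem cls_apply {l : Fin 4} (y : ↥(D.Zt l)) : D.cls l y = Refinement.H1.mk (D.refinement l) (D.toZ1 l y) :=
  rfl

/-! ### Restriction of bounded twisted cocycles -/

/-- **Restriction of bounded twisted cocycles to a lower level.** [cite: GrauertRemmert1977, Kap. VI §4.3] -/
def resZt {l l' : Fin 4} (h : l ≤ l') : ↥(D.Zt l') →L[ℂ] ↥(D.Zt l) :=
  ((D.toDolbeaultLerayDatum.res 0 h 1).comp (D.Zt l').subtypeL).codRestrict (D.Zt l) fun y ↦ by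
    change D.fun1 l (D.toDolbeaultLerayDatum.res 0 h 1 (y : D.Bdd l' 1)).val ∈ (D.refinement l).Z1
    rw [D.fun1_res h]
    exact Refinement.resZ1Fun_mem (D.isShrink h) ⟨_, y.2⟩

/-- Restriction on underlying bounded cochains. [folklore] -/
@[simp] theorem coe_resZt {l l' : Fin 4} (h : l ≤ l') (y : ↥(D.Zt l')) :
    ((D.resZt h y : ↥(D.Zt l)) : D.Bdd l 1) = D.toDolbeaultLerayDatum.res 0 h 1 (y : D.Bdd l' 1) :=
  rfl

/-- Restriction of bounded twisted cocycles on the twisted cocycles. [folklore] -/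
theorem toZ1_resZt {l l' : Fin 4} (h : l ≤ l') (y : ↥(D.Zt l')) :
    D.toZ1 l (D.resZt h y) = Refinement.resZ1 (D.isShrink h) (D.toZ1 l' y) :=
  Subtype.ext (D.fun1_res h _)

/-- **Restriction of bounded twisted cocycles to a strictly lower level is compact** (Montel:
`exists_subseq_tendsto_res`, and the twisted cocycles are closed). [cite: GrauertRemmert1977, Kap. VI §4.2] -/
theorem isCompactOperator_resZt [CompactSpace M] {l l' : Fin 4} (h : l < l') : IsCompactOperator (D.resZt h.le) := by
  refine isCompactOperator_of_subseq _ fun u hu ↦ ?_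
  obtain ⟨c, φ, hφ, hc⟩ := D.toDolbeaultLerayDatum.exists_subseq_tendsto_res 0 h 1 (fun n ↦ (u n : D.Bdd l' 1))
    fun n ↦ hu n
  have hcZ : c ∈ D.Zt l :=
    (D.isClosed_Zt l).mem_of_tendsto hc (Eventually.of_forall fun n ↦ (D.resZt h.le (u (φ n))).2)
  exact ⟨⟨c, hcZ⟩, φ, hφ, tendsto_subtype_rng.2 hc⟩

/-! ### The bounded twisted coboundary -/

/-- The twisted coboundary of the function cochain of a holomorphic `0`-cochain is a twisted cocycle.
[cite: VoisinHodgeI2002, §4.3.1] -/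
theorem δ0Fun_fun0_mem_Z1 (l : Fin 4) (g : CechHolForms E M (D.U l) (D.isOpen l) 0 0) :
    Refinement.δ0Fun (D.refinement l) (D.fun0 l g) ∈ (D.refinement l).Z1 :=
  Refinement.δ0Fun_mem_Z1 (D.refinement l) (D.fun0 l g)
    (Refinement.C0.mdifferentiableOn_sub (D.refinement l) ⟨D.fun0 l g, D.fun0_mem_C0 l g⟩)

/-- **The twisted coboundary on holomorphic `0`-cochains of `(0,0)`-forms**, `(δ b)_ab = b_b - t_ab b_a`
as holomorphic `(0,0)`-forms on the overlaps. [cite: VoisinHodgeI2002, §4.3.1] -/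
def tdeltaVal (l : Fin 4) (g : CechHolForms E M (D.U l) (D.isOpen l) 0 0) : CechHolForms E M (D.U l) (D.isOpen l) 0 1 :=
  D.hol1 l (Refinement.δ0Fun (D.refinement l) (D.fun0 l g)) (D.δ0Fun_fun0_mem_Z1 l g).1
    (D.δ0Fun_fun0_mem_Z1 l g).2.1

/-- The function cochain of the twisted coboundary. [folklore] -/
theorem fun1_tdeltaVal (l : Fin 4) (g : CechHolForms E M (D.U l) (D.isOpen l) 0 0) :
    D.fun1 l (D.tdeltaVal l g) = Refinement.δ0Fun (D.refinement l) (D.fun0 l g) :=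
  D.fun1_hol1 l _ _ _

/-- The twisted coboundary is additive. [folklore] -/
theorem tdeltaVal_add (l : Fin 4) (g g' : CechHolForms E M (D.U l) (D.isOpen l) 0 0) :
    D.tdeltaVal l (g + g') = D.tdeltaVal l g + D.tdeltaVal l g' :=
  D.ext_of_fun1_eq l (by rw [fun1_tdeltaVal, fun1_add, fun1_tdeltaVal, fun1_tdeltaVal, fun0_add, Refinement.δ0Fun_add])

/-- The twisted coboundary is homogeneous. [folklore] -/
theorem tdeltaVal_smul (l : Fin 4) (r : ℂ) (g : CechHolForms E M (D.U l) (D.isOpen l) 0 0) :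
    D.tdeltaVal l (r • g) = r • D.tdeltaVal l g :=
  D.ext_of_fun1_eq l (by rw [fun1_tdeltaVal, fun1_smul, fun1_tdeltaVal, fun0_smul, Refinement.δ0Fun_smul])

variable [CompactSpace M]

/-- **The twisted coboundary is bounded in the sup norms of level `l`, given a higher level `l'`**:
`|b_b(x) - t_ab(x) b_a(x)| ≤ (1 + sup |t_ab|) ‖b‖` with the sup of the transition function over the
compact `closure U_{l,ab} ⊆ U_{l',ab}`, on which it is continuous (Grauert–Remmert: "δ ist stetig").
[cite: GrauertRemmert1977, Kap. VI §4.1] -/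
theorem exists_tdelta_bound {l l' : Fin 4} (h : l < l') :
    ∃ A : ℝ, 0 ≤ A ∧ ∀ (b : D.Bdd l 0) (J : Fin 2 → ↥D.s), ∀ y ∈ D.C 1 J l,
      ‖(((D.tdeltaVal l b.val J : ↥(pqFormsOn E M (cechSet (D.U l) J) 0 0)) :
        MForm 𝓘(ℝ, E) M ℂ (0 + 0))).inChart (D.ctr 1 J) y‖ ≤ A * ‖b‖ := by
  -- a bound of `t_{J0 J1}` on the closure of `U_{l,J}`
  have hT : ∀ J : Fin 2 → ↥D.s, ∃ T : ℝ, ∀ x ∈ closure (cechSet (D.U l) J), ‖(D.refinement l).t (J 0) (J 1) x‖ ≤ T := by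
    intro J
    refine (isClosed_closure (s := cechSet (D.U l) J)).isCompact.exists_bound_of_continuousOn ?_
    refine ((L.mdifferentiableOn_coordChange (D.τ (J 0)) (D.τ (J 1))).continuousOn).mono ?_
    refine (D.closure_subset l l' h _ J).trans fun x hx ↦ ?_
    rw [cechSet_fin_two] at hx
    exact ⟨D.subset_baseSet l' _ hx.1, D.subset_baseSet l' _ hx.2⟩
  choose T hT using hT
  refine ⟨∑ J, (1 + max (T J) 0), Finset.sum_nonneg fun J _ ↦ by positivity, fun b J y hy ↦ ?_⟩
  set m := (extChartAt 𝓘(ℝ, E) (D.ctr 1 J)).symm y with hm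
  have hmU : m ∈ cechSet (D.U l) J := D.symm_mem_cechSet hy
  have hmU' : m ∈ D.U l (J 0) ∩ D.U l (J 1) := by rwa [cechSet_fin_two] at hmU
  have hval : ‖(((D.tdeltaVal l b.val J : ↥(pqFormsOn E M (cechSet (D.U l) J) 0 0)) :
      MForm 𝓘(ℝ, E) M ℂ (0 + 0))).inChart (D.ctr 1 J) y‖ =
      ‖D.fun0 l b.val (J 1) m - (D.refinement l).t (J 0) (J 1) m * D.fun0 l b.val (J 0) m‖ := by
    change ‖(MForm.ofFun 𝓘(ℝ, E) (Refinement.δ0Fun (D.refinement l) (D.fun0 l b.val) (J 0) (J 1))).inChart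
      (D.ctr 1 J) y‖ = _
    rw [MForm.norm_inChart_ofFun, ← hm, Refinement.δ0Fun_apply_of_mem _ _ hmU']
  rw [hval]
  have h1 := D.norm_fun0_le b (J 1) m
  have h0 := D.norm_fun0_le b (J 0) m
  have ht := hT J m (subset_closure hmU)
  have hTle : T J ≤ max (T J) 0 := le_max_left _ _
  calc ‖D.fun0 l b.val (J 1) m - (D.refinement l).t (J 0) (J 1) m * D.fun0 l b.val (J 0) m‖
      ≤ ‖D.fun0 l b.val (J 1) m‖ + ‖(D.refinement l).t (J 0) (J 1) m‖ * ‖D.fun0 l b.val (J 0) m‖ := by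
        refine (norm_sub_le _ _).trans ?_
        rw [norm_mul]
    _ ≤ ‖b‖ + max (T J) 0 * ‖b‖ := by
        gcongr
        exact ht.trans hTle
    _ = (1 + max (T J) 0) * ‖b‖ := by ring
    _ ≤ (∑ J', (1 + max (T J') 0)) * ‖b‖ := by
        gcongr
        exact Finset.single_le_sum (f := fun J' ↦ 1 + max (T J') 0) (fun J' _ ↦ by positivity) (Finset.mem_univ J)

/-- **The twisted coboundary on bounded cochains** of a level `l` below a level `l'`, a bounded operator
`C⁰_b(𝔘_l, 𝒪(L)) → C¹_b(𝔘_l, 𝒪(L))`. [cite: GrauertRemmert1977, Kap. VI §4.1] -/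
def tdeltaB {l l' : Fin 4} (h : l < l') : D.Bdd l 0 →L[ℂ] D.Bdd l 1 :=
  LinearMap.mkContinuousOfExistsBound
    { toFun := fun b ↦ ⟨D.tdeltaVal l b.val, (D.exists_tdelta_bound h).elim fun _ hA ↦
        D.toDolbeaultLerayDatum.memℓp_of_forall 0 _ fun J y hy ↦ hA.2 b J y hy⟩
      map_add' := fun b b' ↦ DolbeaultLerayDatum.Bdd.ext (D.tdeltaVal_add l b.val b'.val)
      map_smul' := fun r b ↦ DolbeaultLerayDatum.Bdd.ext (D.tdeltaVal_smul l r b.val) }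
    ((D.exists_tdelta_bound h).imp fun _ hA b ↦
      D.toDolbeaultLerayDatum.norm_le_of_forall 0 _ (mul_nonneg hA.1 (norm_nonneg _)) fun J y hy ↦ hA.2 b J y hy)

/-- Underlying cochain of the bounded twisted coboundary. [folklore] -/
@[simp] theorem val_tdeltaB {l l' : Fin 4} (h : l < l') (b : D.Bdd l 0) :
    (D.tdeltaB h b).val = D.tdeltaVal l b.val :=
  rfl

/-- **The bounded twisted coboundary into the bounded twisted cocycles** `δ : C⁰_b(𝔘_l, 𝒪(L)) → Z¹_b(𝔘_l, 𝒪(L))`.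
[cite: GrauertRemmert1977, Kap. VI §4.3] -/
def tdelta {l l' : Fin 4} (h : l < l') : D.Bdd l 0 →L[ℂ] ↥(D.Zt l) :=
  (D.tdeltaB h).codRestrict (D.Zt l) fun b ↦ by
    change D.fun1 l (D.tdeltaVal l b.val) ∈ (D.refinement l).Z1
    rw [fun1_tdeltaVal]
    exact D.δ0Fun_fun0_mem_Z1 l b.val

/-- The bounded twisted coboundary on the twisted cocycles: the twisted Čech coboundary of the
function cochain. [folklore] -/
theorem toZ1_tdelta {l l' : Fin 4} (h : l < l') (b : D.Bdd l 0) :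
    D.toZ1 l (D.tdelta h b) = (D.refinement l).δ0 ⟨D.fun0 l b.val, D.fun0_mem_C0 l b.val⟩ :=
  Subtype.ext (D.fun1_tdeltaVal l b.val)

/-- **Coboundaries of bounded cochains have zero class.** [cite: GrauertRemmert1977, Kap. VI §4.3] -/
theorem cls_tdelta {l l' : Fin 4} (h : l < l') (b : D.Bdd l 0) : D.cls l (D.tdelta h b) = 0 := by
  rw [cls_apply, toZ1_tdelta]
  exact Refinement.H1.mk_δ0 _

/-! ### Bounded cocycles and cochains from algebraic ones of a higher level -/

/-- **A twisted cocycle of level `l'` restricts to a BOUNDED twisted cocycle of every lower level**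
(its components are continuous on the compact closures `closure U_{l,ab} ⊆ U_{l',ab}`:
`memℓp_cechHolShrink_of_lt`). [cite: GrauertRemmert1977, Kap. VI §4.3] -/
def ofZ1 {l l' : Fin 4} (h : l < l') (z : (D.refinement l').Z1) : ↥(D.Zt l) :=
  ⟨⟨cechHolShrink E M (D.isOpen l') 0 (D.isOpen l) (D.mono l l' h.le) 1
      (D.hol1 l' z (Refinement.Z1.mdifferentiableOn z) fun _ _ _ hx ↦ Refinement.Z1.apply_eq_zero z hx),
    D.toDolbeaultLerayDatum.memℓp_cechHolShrink_of_lt 0 h 1 _⟩, by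
    change D.fun1 l (cechHolShrink E M (D.isOpen l') 0 (D.isOpen l) (D.mono l l' h.le) 1 _) ∈ (D.refinement l).Z1
    rw [D.fun1_cechHolShrink h.le, fun1_hol1]
    exact Refinement.resZ1Fun_mem (D.isShrink h.le) z⟩

/-- The function cochain of `ofZ1 z` is the cut-off of `z`. [folklore] -/
theorem fun1_ofZ1 {l l' : Fin 4} (h : l < l') (z : (D.refinement l').Z1) :
    D.fun1 l ((D.ofZ1 h z : ↥(D.Zt l)) : D.Bdd l 1).val = Refinement.resZ1Fun (D.refinement l) z := by
  change D.fun1 l (cechHolShrink E M (D.isOpen l') 0 (D.isOpen l) (D.mono l l' h.le) 1 _) = _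
  rw [D.fun1_cechHolShrink h.le, fun1_hol1]

/-- The twisted cocycle of `ofZ1 z` is the restriction of `z`. [folklore] -/
theorem toZ1_ofZ1 {l l' : Fin 4} (h : l < l') (z : (D.refinement l').Z1) :
    D.toZ1 l (D.ofZ1 h z) = Refinement.resZ1 (D.isShrink h.le) z :=
  Subtype.ext (D.fun1_ofZ1 h z)

/-- **A holomorphic `0`-cochain of level `l'` restricts to a BOUNDED `0`-cochain of every lower level.**
[cite: GrauertRemmert1977, Kap. VI §4.3] -/
def ofC0 {l l' : Fin 4} (h : l < l') (b : (D.refinement l').C0) : D.Bdd l 0 :=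
  ⟨cechHolShrink E M (D.isOpen l') 0 (D.isOpen l) (D.mono l l' h.le) 0
      (D.hol0 l' b (Refinement.C0.mdifferentiableOn b) fun _ _ hx ↦ Refinement.C0.apply_eq_zero b hx),
    D.toDolbeaultLerayDatum.memℓp_cechHolShrink_of_lt 0 h 0 _⟩

/-- The function cochain of `ofC0 b` is the cut-off of `b`. [folklore] -/
theorem fun0_ofC0 {l l' : Fin 4} (h : l < l') (b : (D.refinement l').C0) :
    D.fun0 l (D.ofC0 h b).val = Refinement.resC0Fun (D.refinement l) b := by
  change D.fun0 l (cechHolShrink E M (D.isOpen l') 0 (D.isOpen l) (D.mono l l' h.le) 0 _) = _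
  rw [D.fun0_cechHolShrink h.le, fun0_hol0]

/-! ### The cohomological inputs of Schwartz's theorem -/

/-- **Every class of level `l₀` is the class of a bounded twisted cocycle restricted from level `l₁`**
(restriction `Ȟ¹(𝔘_{l₂}) → Ȟ¹(𝔘_{l₀})` is onto for the acyclic covers, then restrict a representing
cocycle of level `l₂` to level `l₁`, where it is bounded). [cite: GrauertRemmert1977, Kap. VI §4.3] -/
theorem exists_cls_resZt_eq {l₀ l₁ l₂ : Fin 4} (h₀₁ : l₀ < l₁) (h₁₂ : l₁ < l₂)
    (c : (D.refinement l₀).H1) : ∃ y : ↥(D.Zt l₁), D.cls l₀ (D.resZt h₀₁.le y) = c := by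
  obtain ⟨ξ, rfl⟩ := (Refinement.resH1_bijective (D.isShrink (h₀₁.le.trans h₁₂.le)) (D.isDolbeaultAcyclic l₂)).2 c
  obtain ⟨z, rfl⟩ := Refinement.H1.mk_surjective ξ
  refine ⟨D.ofZ1 h₁₂ z, ?_⟩
  rw [cls_apply, toZ1_resZt, toZ1_ofZ1, Refinement.resZ1_resZ1, Refinement.resH1_mk]

/-- **Controlled solvability** (the cohomological input of Schwartz's theorem): for a bounded twisted
cocycle `y` of level `l₁` there are a bounded twisted cocycle `x` of level `l₂` and a bounded cochain
`w` of level `l₀` with `res res x = res y + δ w` on level `l₀` — represent the class of `y` at level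
`l₃` (restriction `Ȟ¹(𝔘_{l₃}) → Ȟ¹(𝔘_{l₁})` is onto: `res z - y = δ η` on level `l₁`), restrict `z`
to level `l₂` and `η` to level `l₀`, where they are bounded. [cite: GrauertRemmert1977, Kap. VI §4.3] -/
theorem exists_resZt_resZt_eq_add_tdelta {l₀ l₁ l₂ l₃ : Fin 4} (h₀₁ : l₀ < l₁)
    (h₁₂ : l₁ < l₂) (h₂₃ : l₂ < l₃) (y : ↥(D.Zt l₁)) :
    ∃ (x : ↥(D.Zt l₂)) (w : D.Bdd l₀ 0),
      D.resZt h₀₁.le (D.resZt h₁₂.le x) = D.resZt h₀₁.le y + D.tdelta h₀₁ w := by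
  have h₁₃ : l₁ ≤ l₃ := h₁₂.le.trans h₂₃.le
  obtain ⟨ξ, hξ⟩ := (Refinement.resH1_bijective (D.isShrink h₁₃) (D.isDolbeaultAcyclic l₃)).2
    (Refinement.H1.mk _ (D.toZ1 l₁ y))
  obtain ⟨z, rfl⟩ := Refinement.H1.mk_surjective ξ
  rw [Refinement.resH1_mk] at hξ
  have hcob : Refinement.H1.mk _ (Refinement.resZ1 (D.isShrink h₁₃) z - D.toZ1 l₁ y) = 0 := by
    rw [map_sub, hξ, sub_self]
  obtain ⟨η, hη⟩ := (Refinement.H1.mk_eq_zero_iff _).1 hcob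
  refine ⟨D.ofZ1 h₂₃ z, D.ofC0 h₀₁ η, Subtype.ext (D.Bdd_ext_of_fun1_eq ?_)⟩
  rw [coe_resZt, fun1_res, coe_resZt, fun1_res, fun1_ofZ1, Submodule.coe_add, DolbeaultLerayDatum.Bdd.val_add,
    fun1_add, coe_resZt, fun1_res]
  change _ = _ + D.fun1 l₀ (D.tdeltaVal l₀ (D.ofC0 h₀₁ η).val)
  rw [fun1_tdeltaVal, fun0_ofC0]
  funext a b x
  by_cases hx : x ∈ D.U l₀ a ∩ D.U l₀ b
  · have hx₁ : x ∈ D.U l₁ a ∩ D.U l₁ b := (D.isShrink h₀₁.le).inter_subset a b hx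
    have hx₂ : x ∈ D.U l₂ a ∩ D.U l₂ b := (D.isShrink h₁₂.le).inter_subset a b hx₁
    have hηx := congrArg (fun c : (D.refinement l₁).Z1 ↦ (c : ↥D.s → ↥D.s → M → ℂ) a b x) hη
    simp only [Submodule.coe_sub, Pi.sub_apply] at hηx
    rw [Refinement.δ0_apply_of_mem _ hx₁, Refinement.resZ1_apply_of_mem _ _ hx₁, coe_toZ1] at hηx
    rw [Pi.add_apply, Pi.add_apply, Pi.add_apply, Refinement.resZ1Fun_apply_of_mem _ hx,
      Refinement.resZ1Fun_apply_of_mem _ hx₁, Refinement.resZ1Fun_apply_of_mem _ hx₂,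
      Refinement.resZ1Fun_apply_of_mem _ hx, Refinement.δ0Fun_apply_of_mem _ _ hx,
      Refinement.resC0Fun_apply_of_mem (a := b) _ hx.2, Refinement.resC0Fun_apply_of_mem (a := a) _ hx.1,
      D.refinement_t l₀ l₁]
    linear_combination -hηx
  · rw [Pi.add_apply, Pi.add_apply, Pi.add_apply, Refinement.resZ1Fun_apply_of_notMem _ hx,
      Refinement.resZ1Fun_apply_of_notMem _ hx, Refinement.δ0Fun_apply_of_notMem _ _ hx, add_zero]

/-! ### The finiteness theorems -/

/-- **Finiteness of the twisted Čech cohomology of the lowest level**, `dim Ȟ¹(𝔘₀, 𝒪(L)) < ∞`, for a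
compact Hausdorff complex manifold carrying a twisted nested Leray datum (Cartan–Serre (1953) for the
coherent sheaf `𝒪(L)`; Grauert–Remmert (1977), Kap. VI §4.3, Endlichkeitssatz, via Schwartz's
theorem `Module.finite_of_compact_restriction` with `X, Y, V` the bounded twisted cocycles of levels
`2, 1, 0`, `W` the bounded `0`-cochains of level `0`, `r₁, r₂` restriction, `d` the twisted
coboundary). [cite: GrauertRemmert1977, Kap. VI §4.3] -/
theorem finite_H1 : Module.Finite ℂ (D.refinement 0).H1 := by
  have h01 : (0 : Fin 4) < 1 := by decide
  have h12 : (1 : Fin 4) < 2 := by decide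
  have h23 : (2 : Fin 4) < 3 := by decide
  exact Module.finite_of_compact_restriction (D.resZt h12.le) (D.resZt h01.le) (D.tdelta h01)
    (D.isCompactOperator_resZt h12) (D.exists_resZt_resZt_eq_add_tdelta h01 h12 h23) (D.cls 0)
    (D.cls_tdelta h01) (D.exists_cls_resZt_eq h01 h12)

end Spaces

end TwistedLerayDatum

/-- **The Cartan–Serre finiteness theorem with coefficients in a holomorphic line bundle**: on a
compact Hausdorff complex manifold the twisted Dolbeault group `H^{0,1}(M, L) ≅ H¹(M, 𝒪(L))` of a
holomorphic line cocycle `L` is finite-dimensional (H. Cartan, J.-P. Serre (1953); Grauert–Remmert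
(1977), Kap. VI §4; Voisin I, Cor. 5.25 with Thm. 4.41: `Ȟ¹(𝔘₀, 𝒪(L))` is finite-dimensional and
isomorphic to `H^{0,1}(M, L)` by Leray). [cite: CartanSerre1953] -/
theorem finite_H01 [FiniteDimensional ℂ E] [T2Space M] [CompactSpace M] [IsManifold 𝓘(ℂ, E) ω M]
    [IsManifold 𝓘(ℝ, E) ∞ M] (L : HolomorphicLineBundle ι E M) : Module.Finite ℂ L.H01 := by
  obtain ⟨D⟩ := nonempty_twistedLerayDatum L
  haveI := D.finite_H1
  obtain ⟨e⟩ := (D.refinement 0).nonempty_H1_equiv_H01 (D.isDolbeaultAcyclic 0)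
  exact Module.Finite.equiv e

end HolomorphicLineBundle

end Literature.Geometry.Kaehler

end
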